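import Mathlib
import HarnessLib
import Literature.Analysis.FluidPDE.TypeIAncientMildClassical
import Literature.Analysis.FluidPDE.ClassicalSolution
import Literature.Analysis.FluidPDE.Vorticity
import Literature.Analysis.FluidPDE.VorticityCalculus
import Literature.Analysis.FluidPDE.VorticityEquation
import Literature.Analysis.FluidPDE.AxisymmetricVorticityTransport
import Literature.Analysis.FluidPDE.LerayProfileCalculus
import Summits.NavierStokesRegularity.NavierStokesRegularity.Theorems.PoloidalWindowDoorPoloidalWindowRigidityWindow

/-!
# Door S11 `LocalTubeDoorHelicity` (nsreg-p1 ROUND-11), profile crux K2⁗ `FrobeniusProfileRigidity` — the FROZEN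
# CONSTRAINT (C₁) of the Frobenius class `𝔉 = {v · curl v ≡ 0}`

Cell ns-regularity-ideate, seat p6 (route-directed support for an UNSTAGED door; anchor
`--supports stmt-NavierStokesRegularity-20018`; edge re-pointed at birth).  nsreg-p1 ROUND-11 §2 (C₁) (hand identity,
"checked twice") — here kernel-checked: along a classical Navier–Stokes flow whose helicity density `h = u · ω`,
`ω = curl u`, vanishes identically, the SOURCE TERM of the local helicity balance
`(∂ₜ + u·∇ − νΔ) h = ω·∇(|u|²/2 − p) − 2ν ∇u:∇ω` vanishes:

  **`ω · ∇p − ω · ∇(|u|²/2) = −2ν ∇u : ∇ω`**,  with `ω · ∇(|u|²/2) = ⟪u, (ω·∇)u⟫`, `∇u : ∇ω = Σᵢ ⟪∂ᵢu, ∂ᵢω⟫`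

(note the sign: NOT the Bernoulli head `p + |u|²/2`).  Derivation (all classical, pointwise): `0 = ∂ₜ(u·ω) = ω·∂ₜu +
u·∂ₜω` (the helicity density is constant in time — `HasDerivWithinAt.inner` + uniqueness of one-sided derivatives on the
open time set); insert the momentum equation `∂ₜu = νΔu − (u·∇)u − ∇p` (`IsClassicalNSSolutionOn.momentum`) and the
vorticity equation `∂ₜω = νΔω − (u·∇)ω + (ω·∇)u` (`IsClassicalNSSolutionOn.isVorticitySolutionOn_zero_force`); the
transport terms give `(u·∇)(u·ω) = 0` (`fderiv_inner_apply` of the vanishing scalar), the stretching term gives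
`u·(ω·∇)u`, and the viscous terms give `ν(ω·Δu + u·Δω) = ν(Δ(u·ω) − 2∇u:∇ω) = −2ν ∇u:∇ω` (Leibniz rule for the Laplacian
of an inner product, tree `laplacian_inner_eq`).

* `helicityFree_frozenConstraint` — the identity for any classical solution of the unforced system (viscosity `ν`) on an
  OPEN time set with `u · curl u ≡ 0` there, in any orthonormal basis;
* `exists_pressure_of_class` — a profile of the route's Type-I class solves Navier–Stokes classically (`ν = 1`) on
  every window `(t₀, 0)` for some smooth pressure (tree `IsTypeIAncientMild.exists_isClassicalNSSolutionOn_Ioo` through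
  `isTypeIAncientMild_of_class`) — so the next statement is not vacuous;
* `frozenConstraint_of_class` — **(C₁) on the Frobenius class**: for a profile of the Type-I class with `v · curl v ≡ 0`
  and ANY such pressure `p` on a window `(t₀,0)`:
  `⟪curl v(s), ∇p(s)⟫ − ⟪v(s), Dv(s)(curl v(s))⟫ = −2 Σᵢ ⟪∂ᵢ v(s), ∂ᵢ curl v(s)⟫` at every `s ∈ (t₀,0)`, `y ∈ ℝ³`.

WHAT THIS IS NOT: not a claim about Navier–Stokes regularity and not K2⁗ — a pointwise identity (the class's first
integral / constraint, the `𝔉`-analogue of the poloidal `stub_firstIntegral`) for a door route that is not yet staged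
(bears_on LADDER-NS N0).
-/

noncomputable section

-- the summit and its single sub-problem share the name (CONVENTIONS §1), as in every Theorems file
set_option linter.dupNamespace false

namespace Summit.NavierStokesRegularity.NavierStokesRegularity.Theorems.LocalHelicityTubeDoorFrobeniusProfileRigidityFrozen

open MeasureTheory Set Function Filter Topology TopologicalSpace Metric InnerProductSpace
open scoped Laplacian RealInnerProductSpace InnerProductSpace
open Literature.Analysis Literature.Analysis.FluidPDE
open Summit.NavierStokesRegularity.NavierStokesRegularity.Theorems.PoloidalWindowDoorPoloidalWindowRigidityWindow

/-- **The frozen constraint of helicity-free classical flows.**  Let `(u, p)` be a classical solution of the unforced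
Navier–Stokes system with viscosity `ν` on an open time set `S`, and suppose the helicity density vanishes identically:
`⟪u t x, curl (u t) x⟫ = 0` for all `t ∈ S`, `x`.  Then for every `t ∈ S`, `x`, and every orthonormal basis `b` of `ℝ³`,
`⟪curl u, ∇p⟫ − ⟪u, Du (curl u)⟫ = −2ν Σᵢ ⟪Du (bᵢ), D(curl u) (bᵢ)⟫` at `(t, x)` — i.e.
`ω·∇(p − |u|²/2) = −2ν ∇u:∇ω`, the vanishing of the source term of the local helicity balance. -/
theorem helicityFree_frozenConstraint {ι : Type*} [Fintype ι] (b : OrthonormalBasis ι ℝ (EuclideanSpace ℝ (Fin 3)))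
    {S : Set ℝ} (hSo : IsOpen S) {ν : ℝ}
    {u : ℝ → EuclideanSpace ℝ (Fin 3) → EuclideanSpace ℝ (Fin 3)} {p : ℝ → EuclideanSpace ℝ (Fin 3) → ℝ}
    (hns : IsClassicalNSSolutionOn S ν 0 u p)
    (hhel : ∀ t ∈ S, ∀ x, ⟪u t x, curl (u t) x⟫_ℝ = 0) {t : ℝ} (ht : t ∈ S) (x : EuclideanSpace ℝ (Fin 3)) :
    ⟪curl (u t) x, gradient (p t) x⟫_ℝ - ⟪u t x, fderiv ℝ (u t) x (curl (u t) x)⟫_ℝ =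
      -2 * ν * ∑ i, ⟪fderiv ℝ (u t) x (b i), fderiv ℝ (curl (u t)) x (b i)⟫_ℝ := by
  have hS : UniqueDiffOn ℝ S := hSo.uniqueDiffOn
  have hV : IsVorticitySolutionOn S ν u :=
    hns.isVorticitySolutionOn_zero_force hS (by rw [hSo.interior_eq]; exact subset_closure)
  -- ## smoothness of the slice and of its curl
  have hu3 : ContDiff ℝ 3 (u t) := contDiff_infty.1 (hns.contDiff_velocity ht) 3
  have hU2 : ContDiff ℝ 2 (u t) := hu3.of_le (by norm_cast)
  have hΩ2 : ContDiff ℝ 2 (curl (u t)) := contDiff_curl (n := 2) (by exact_mod_cast hu3)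
  have hUd : ∀ y, DifferentiableAt ℝ (u t) y := fun y => (hU2.differentiable (by norm_num)) y
  have hΩd : ∀ y, DifferentiableAt ℝ (curl (u t)) y := fun y => (hΩ2.differentiable (by norm_num)) y
  -- the helicity density of the slice is the zero function
  have hfun : (fun y => ⟪u t y, curl (u t) y⟫_ℝ) = fun _ => (0 : ℝ) := funext fun y => hhel t ht y
  -- ## (T) the helicity density is constant in time: `⟪u, ∂ₜω⟫ + ⟪∂ₜu, ω⟫ = 0`
  have hdu : HasDerivWithinAt (fun τ => u τ x) (timeDerivWithin S u t x) S t := by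
    rw [timeDerivWithin_apply]
    exact (hns.smooth_velocity.differentiableWithinAt_time ht x).hasDerivWithinAt
  have hdω : HasDerivWithinAt (fun τ => vorticity u τ x) (timeDerivWithin S (vorticity u) t x) S t := by
    rw [timeDerivWithin_apply]
    exact ((hns.smooth_velocity.isSmoothSpaceTimeOn_vorticity hS).differentiableWithinAt_time ht x).hasDerivWithinAt
  have hprod := hdu.inner ℝ hdω
  have hzero : HasDerivWithinAt (fun τ => ⟪u τ x, vorticity u τ x⟫_ℝ) 0 S t := by
    have hev : ∀ τ ∈ S, ⟪u τ x, vorticity u τ x⟫_ℝ = (fun _ : ℝ => (0 : ℝ)) τ := fun τ hτ => by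
      rw [vorticity_apply]; exact hhel τ hτ x
    exact (hasDerivWithinAt_const t S (0 : ℝ)).congr hev (hev t ht)
  have hT : ⟪u t x, timeDerivWithin S (vorticity u) t x⟫_ℝ + ⟪timeDerivWithin S u t x, vorticity u t x⟫_ℝ = 0 :=
    (hS t ht).eq_deriv _ hprod hzero
  rw [vorticity_apply] at hT
  -- ## (X) the transport terms: `⟪u, (u·∇)ω⟫ + ⟪(u·∇)u, ω⟫ = (u·∇)(u·ω) = 0`
  have hX : ⟪u t x, fderiv ℝ (curl (u t)) x (u t x)⟫_ℝ + ⟪fderiv ℝ (u t) x (u t x), curl (u t) x⟫_ℝ = 0 := by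
    have h := fderiv_inner_apply ℝ (hUd x) (hΩd x) (u t x)
    rw [hfun] at h
    simpa using h.symm
  -- ## (L) the viscous terms: `⟪Δu, ω⟫ + ⟪u, Δω⟫ + 2 ∇u:∇ω = Δ(u·ω) = 0`
  have hL : ⟪(Δ (u t)) x, curl (u t) x⟫_ℝ + ⟪u t x, (Δ (curl (u t))) x⟫_ℝ +
      2 * ∑ i, ⟪fderiv ℝ (u t) x (b i), fderiv ℝ (curl (u t)) x (b i)⟫_ℝ = 0 := by
    have h := laplacian_inner_eq b hU2 hΩ2 x
    rw [hfun, laplacian_const_eq_zero] at h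
    exact h.symm
  -- ## (M) the momentum equation against `ω`, (W) the vorticity equation against `u`
  have hM : ⟪timeDerivWithin S u t x, curl (u t) x⟫_ℝ + ⟪fderiv ℝ (u t) x (u t x), curl (u t) x⟫_ℝ =
      ν * ⟪(Δ (u t)) x, curl (u t) x⟫_ℝ - ⟪gradient (p t) x, curl (u t) x⟫_ℝ := by
    have h := congrArg (fun z => ⟪z, curl (u t) x⟫_ℝ) (hns.momentum t ht x)
    simpa only [convect_apply, Pi.zero_apply, add_zero, inner_add_left, inner_sub_left, real_inner_smul_left]
      using h
  have hW : ⟪u t x, timeDerivWithin S (vorticity u) t x⟫_ℝ + ⟪u t x, fderiv ℝ (curl (u t)) x (u t x)⟫_ℝ =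
      ⟪u t x, fderiv ℝ (u t) x (curl (u t) x)⟫_ℝ + ν * ⟪u t x, (Δ (curl (u t))) x⟫_ℝ := by
    have h := congrArg (fun z => ⟪u t x, z⟫_ℝ) (hV.vorticity_eq t ht x)
    simpa only [convect_apply, vorticity_apply, inner_add_right, real_inner_smul_right] using h
  have hP : ⟪curl (u t) x, gradient (p t) x⟫_ℝ = ⟪gradient (p t) x, curl (u t) x⟫_ℝ := real_inner_comm _ _
  linear_combination hP + hM + hW - hT - hX + ν * hL

/-- **Profiles of the route's Type-I class have a classical pressure on every window** `(t₀, 0)`, `t₀ < 0`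
(`ν = 1`, zero force): tree `IsTypeIAncientMild.exists_isClassicalNSSolutionOn_Ioo` (KNSS 2009 Rem. 4.1 +
Fabes–Jones–Rivière) through `isTypeIAncientMild_of_class`. -/
theorem exists_pressure_of_class {C : ℝ} {v : ℝ → EuclideanSpace ℝ (Fin 3) → EuclideanSpace ℝ (Fin 3)}
    (hrate : HasTypeITimeDecay C v) (hcont : ContinuousOn (uncurry v) (Iio (0 : ℝ) ×ˢ univ))
    (hmild : ∀ s t : ℝ, s < t → t < 0 → ∀ x,
      v t x = UnboundedOperators.heatExtension (v s) (t - s) x - oseenDuhamel 1 s v v t x)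
    (hdiv : ∀ t < 0, VectorCalculus.IsDivFree (v t)) {t₀ : ℝ} (ht₀ : t₀ < 0) :
    ∃ p : ℝ → EuclideanSpace ℝ (Fin 3) → ℝ, IsClassicalNSSolutionOn (Ioo t₀ 0) 1 0 v p :=
  (isTypeIAncientMild_of_class hrate hcont hmild hdiv).exists_isClassicalNSSolutionOn_Ioo ht₀

/-- **(C₁) THE FROZEN CONSTRAINT OF THE FROBENIUS CLASS.**  For a profile of the route's Type-I class (rate, continuity
on the open slab, unit-viscosity Oseen–Duhamel identity, divergence-free slices) with identically vanishing helicity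
density, and any pressure `p` making it a classical solution on a window `(t₀, 0)` (such `p` exist,
`exists_pressure_of_class`), at every `s ∈ (t₀, 0)` and `y ∈ ℝ³`:
`⟪curl v(s,y), ∇p(s,y)⟫ − ⟪v(s,y), Dv(s,y)(curl v(s,y))⟫ = −2 Σᵢ ⟪∂ᵢv(s,y), ∂ᵢ curl v(s,y)⟫` (standard basis), i.e.
`ω·∇(p − |v|²/2) = −2 ∇v:∇ω` (nsreg-p1 ROUND-11 §2 (C₁)). -/
theorem frozenConstraint_of_class :
    ∀ (C : ℝ) (v : ℝ → EuclideanSpace ℝ (Fin 3) → EuclideanSpace ℝ (Fin 3)),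
    Literature.Analysis.FluidPDE.HasTypeITimeDecay C v →
    ContinuousOn (Function.uncurry v) (Set.Iio (0 : ℝ) ×ˢ Set.univ) →
    (∀ s t : ℝ, s < t → t < 0 → ∀ x, v t x =
      Literature.Analysis.UnboundedOperators.heatExtension (v s) (t - s) x -
        Literature.Analysis.FluidPDE.oseenDuhamel 1 s v v t x) →
    (∀ t < 0, Literature.Analysis.FluidPDE.VectorCalculus.IsDivFree (v t)) →
    (∀ s < 0, ∀ y : EuclideanSpace ℝ (Fin 3), ⟪v s y, Literature.Analysis.FluidPDE.curl (v s) y⟫_ℝ = 0) →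
    ∀ t₀ < 0, ∀ (p : ℝ → EuclideanSpace ℝ (Fin 3) → ℝ),
    Literature.Analysis.FluidPDE.IsClassicalNSSolutionOn (Set.Ioo t₀ 0) 1 0 v p →
    ∀ s ∈ Set.Ioo t₀ 0, ∀ y : EuclideanSpace ℝ (Fin 3),
      ⟪Literature.Analysis.FluidPDE.curl (v s) y, gradient (p s) y⟫_ℝ -
          ⟪v s y, fderiv ℝ (v s) y (Literature.Analysis.FluidPDE.curl (v s) y)⟫_ℝ =
        -2 * ∑ i : Fin 3, ⟪fderiv ℝ (v s) y (EuclideanSpace.basisFun (Fin 3) ℝ i),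
          fderiv ℝ (Literature.Analysis.FluidPDE.curl (v s)) y (EuclideanSpace.basisFun (Fin 3) ℝ i)⟫_ℝ := by
  intro C v _ _ _ _ hhel t₀ _ p hns s hs y
  have h := helicityFree_frozenConstraint (EuclideanSpace.basisFun (Fin 3) ℝ) isOpen_Ioo hns
    (fun t ht x => hhel t ht.2 x) hs y
  simpa using h

/-- **The local helicity balance (general `h`, no vanishing assumption).**  For a classical solution `(u, p)` of the
unforced Navier–Stokes system with viscosity `ν` on an OPEN time set `S`, the helicity density `h = ⟪u, curl u⟫` satisfies,
pointwise at every `t ∈ S`, `x`, in any orthonormal basis `b`: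
`∂ₜh + (u·∇)h − ν Δh = ⟪u, Du(ω)⟫ − ⟪ω, ∇p⟫ − 2ν Σᵢ ⟪Du(bᵢ), Dω(bᵢ)⟫`, `ω = curl u`
— i.e. `(∂ₜ + u·∇ − νΔ) h = ω·∇(|u|²/2 − p) − 2ν ∇u:∇ω` (the classical local helicity balance; `ω·∇(|u|²/2) = ⟪u,(ω·∇)u⟫`).
Here `∂ₜh` is the one-sided time derivative within `S`, `(u·∇)h = Dh(u)` and `Δh` the Laplacian of the slice scalar.
Ingredients: `HasDerivWithinAt.inner`, `fderiv_inner_apply`, the tree's `laplacian_inner_eq`, the momentum equation and the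
vorticity equation (`IsClassicalNSSolutionOn.isVorticitySolutionOn_zero_force`).  Setting `h ≡ 0` recovers
`helicityFree_frozenConstraint` (C₁). -/
theorem helicityDensity_transport {ι : Type*} [Fintype ι] (b : OrthonormalBasis ι ℝ (EuclideanSpace ℝ (Fin 3)))
    {S : Set ℝ} (hSo : IsOpen S) {ν : ℝ}
    {u : ℝ → EuclideanSpace ℝ (Fin 3) → EuclideanSpace ℝ (Fin 3)} {p : ℝ → EuclideanSpace ℝ (Fin 3) → ℝ}
    (hns : IsClassicalNSSolutionOn S ν 0 u p) {t : ℝ} (ht : t ∈ S) (x : EuclideanSpace ℝ (Fin 3)) :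
    derivWithin (fun τ => ⟪u τ x, curl (u τ) x⟫_ℝ) S t
        + fderiv ℝ (fun y => ⟪u t y, curl (u t) y⟫_ℝ) x (u t x)
        - ν * (Δ (fun y => ⟪u t y, curl (u t) y⟫_ℝ)) x =
      ⟪u t x, fderiv ℝ (u t) x (curl (u t) x)⟫_ℝ - ⟪curl (u t) x, gradient (p t) x⟫_ℝ
        - 2 * ν * ∑ i, ⟪fderiv ℝ (u t) x (b i), fderiv ℝ (curl (u t)) x (b i)⟫_ℝ := by
  have hS : UniqueDiffOn ℝ S := hSo.uniqueDiffOn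
  have hV : IsVorticitySolutionOn S ν u :=
    hns.isVorticitySolutionOn_zero_force hS (by rw [hSo.interior_eq]; exact subset_closure)
  -- ## smoothness of the slice and of its curl
  have hu3 : ContDiff ℝ 3 (u t) := contDiff_infty.1 (hns.contDiff_velocity ht) 3
  have hU2 : ContDiff ℝ 2 (u t) := hu3.of_le (by norm_cast)
  have hΩ2 : ContDiff ℝ 2 (curl (u t)) := contDiff_curl (n := 2) (by exact_mod_cast hu3)
  have hUd : ∀ y, DifferentiableAt ℝ (u t) y := fun y => (hU2.differentiable (by norm_num)) y
  have hΩd : ∀ y, DifferentiableAt ℝ (curl (u t)) y := fun y => (hΩ2.differentiable (by norm_num)) y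
  -- ## (T) the time derivative of the helicity density
  have hdu : HasDerivWithinAt (fun τ => u τ x) (timeDerivWithin S u t x) S t := by
    rw [timeDerivWithin_apply]
    exact (hns.smooth_velocity.differentiableWithinAt_time ht x).hasDerivWithinAt
  have hdω : HasDerivWithinAt (fun τ => vorticity u τ x) (timeDerivWithin S (vorticity u) t x) S t := by
    rw [timeDerivWithin_apply]
    exact ((hns.smooth_velocity.isSmoothSpaceTimeOn_vorticity hS).differentiableWithinAt_time ht x).hasDerivWithinAt
  have hT : derivWithin (fun τ => ⟪u τ x, curl (u τ) x⟫_ℝ) S t =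
      ⟪u t x, timeDerivWithin S (vorticity u) t x⟫_ℝ + ⟪timeDerivWithin S u t x, curl (u t) x⟫_ℝ := by
    have h := (hdu.inner ℝ hdω).derivWithin (hS t ht)
    simpa only [vorticity_apply] using h
  -- ## (X) the convective derivative of the helicity density
  have hX : fderiv ℝ (fun y => ⟪u t y, curl (u t) y⟫_ℝ) x (u t x) =
      ⟪u t x, fderiv ℝ (curl (u t)) x (u t x)⟫_ℝ + ⟪fderiv ℝ (u t) x (u t x), curl (u t) x⟫_ℝ :=
    fderiv_inner_apply ℝ (hUd x) (hΩd x) (u t x)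
  -- ## (L) the Laplacian of the helicity density
  have hL : (Δ (fun y => ⟪u t y, curl (u t) y⟫_ℝ)) x = ⟪(Δ (u t)) x, curl (u t) x⟫_ℝ + ⟪u t x, (Δ (curl (u t))) x⟫_ℝ +
      2 * ∑ i, ⟪fderiv ℝ (u t) x (b i), fderiv ℝ (curl (u t)) x (b i)⟫_ℝ :=
    laplacian_inner_eq b hU2 hΩ2 x
  -- ## (M) the momentum equation against `ω`, (W) the vorticity equation against `u`
  have hM : ⟪timeDerivWithin S u t x, curl (u t) x⟫_ℝ + ⟪fderiv ℝ (u t) x (u t x), curl (u t) x⟫_ℝ =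
      ν * ⟪(Δ (u t)) x, curl (u t) x⟫_ℝ - ⟪gradient (p t) x, curl (u t) x⟫_ℝ := by
    have h := congrArg (fun z => ⟪z, curl (u t) x⟫_ℝ) (hns.momentum t ht x)
    simpa only [convect_apply, Pi.zero_apply, add_zero, inner_add_left, inner_sub_left, real_inner_smul_left]
      using h
  have hW : ⟪u t x, timeDerivWithin S (vorticity u) t x⟫_ℝ + ⟪u t x, fderiv ℝ (curl (u t)) x (u t x)⟫_ℝ =
      ⟪u t x, fderiv ℝ (u t) x (curl (u t) x)⟫_ℝ + ν * ⟪u t x, (Δ (curl (u t))) x⟫_ℝ := by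
    have h := congrArg (fun z => ⟪u t x, z⟫_ℝ) (hV.vorticity_eq t ht x)
    simpa only [convect_apply, vorticity_apply, inner_add_right, real_inner_smul_right] using h
  have hP : ⟪curl (u t) x, gradient (p t) x⟫_ℝ = ⟪gradient (p t) x, curl (u t) x⟫_ℝ := real_inner_comm _ _
  linear_combination hT + hX - ν * hL + hM + hW + hP

end Summit.NavierStokesRegularity.NavierStokesRegularity.Theorems.LocalHelicityTubeDoorFrobeniusProfileRigidityFrozen

end
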